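import Literature.AlgebraicGeometry.Morphisms.CechModuleShortExact
import Literature.AlgebraicGeometry.Modules.Torsion
import Mathlib.AlgebraicGeometry.Noetherian
import Mathlib.AlgebraicGeometry.Morphisms.Finite
import Mathlib.RingTheory.IntegralClosure.IsIntegralClosure.Basic
import HarnessLib

/-!
# Sheaves of modules of affine-finite type (finitely generated sections on affine opens)

A sheaf of `𝒪_X`-modules `M` is of **affine-finite type** (`IsAffineFiniteType M`) if `Γ(V, M)` is a
finitely generated `Γ(V, 𝒪_X)`-module for every affine open `V`. For an affine-localizing `M`
(`Modules/AffineLocalizing`, i.e. quasi-coherent in the sense of EGA I 1.4.1) on a locally Noetherian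
scheme this is coherence (Hartshorne II Prop. 5.4: "`𝓕` is coherent if and only if ... `M` be a
finitely generated `A`-module"; The Stacks Project, Tag 01XZ). We record the closure properties a
dévissage of coherent modules uses (Görtz–Wedhorn I, Lemma 12.63 (a), (b)), proved on sections:

* `IsAffineFiniteType.unit`, `.of_iso`, `.pushforward_unit` (along finite morphisms);
* `.of_app_injective` (submodules, `X` locally Noetherian), hence `.kernel`, `.torsion`;
* `.of_shortExact₃` (quotients) and `.of_shortExact₂` (extensions) for short exact sequences whose kernel
  is affine-localizing (so that sections over affine opens are right exact,
  `Morphisms/CechModuleShortExact`, Hartshorne II Prop. 5.6).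

Everything is proved; no named facts. Mathlib searched (pin v4.32): `IsLocallyNoetherian.component_noetherian`,
`Module.Finite.of_injective`, `Module.Finite.of_surjective`, `Submodule.fg_of_fg_map_of_fg_inf_ker` (used);
Mathlib has no coherence / finite-type predicate for `Scheme.Modules`.

## References

* R. Hartshorne, *Algebraic Geometry*, GTM 52 (1977): II Prop. 5.4 (p. 113), Prop. 5.6, Prop. 5.7.
  [Hartshorne1977]
* U. Görtz, T. Wedhorn, *Algebraic Geometry I: Schemes*, 2nd ed. (2020): Lemma 12.63, p. 436.
  [GortzWedhorn2020]
* The Stacks Project, Tag 01XZ (Cohomology of Schemes, Lemma 30.9.1: coherent on locally Noetherian).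
  [StacksProject]
-/

noncomputable section

open CategoryTheory AlgebraicGeometry Limits TopologicalSpace Opposite
open Literature.AlgebraicGeometry.Morphisms

universe u

namespace Literature.AlgebraicGeometry.Modules

variable {X : Scheme.{u}}

/-- **Affine-finite type**: `Γ(V, M)` is a finitely generated `Γ(V, 𝒪_X)`-module for every affine open
`V`. [cite: Hartshorne1977, II Prop. 5.4 (p. 113)] -/
def IsAffineFiniteType (M : X.Modules) : Prop :=
  ∀ ⦃V : X.Opens⦄, IsAffineOpen V → Module.Finite Γ(X, V) Γ(M, V)

/-- The action of a morphism of `𝒪_X`-modules on sections over `V`, as a `Γ(V, 𝒪_X)`-linear map.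
[folklore] -/
def appLinear {M N : X.Modules} (φ : M ⟶ N) (V : X.Opens) : Γ(M, V) →ₗ[Γ(X, V)] Γ(N, V) where
  toFun m := φ.app V m
  map_add' m m' := map_add (φ.app V).hom m m'
  map_smul' t m := Scheme.Modules.Hom.app_smul φ t m

/-- `appLinear` is `app`. [folklore] -/
theorem appLinear_apply {M N : X.Modules} (φ : M ⟶ N) (V : X.Opens) (m : Γ(M, V)) :
    appLinear φ V m = φ.app V m := rfl

namespace IsAffineFiniteType

/-- The structure sheaf is of affine-finite type. [folklore] -/
theorem unit : IsAffineFiniteType (SheafOfModules.unit X.ringCatSheaf) :=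
  fun V _ => inferInstanceAs (Module.Finite Γ(X, V) Γ(X, V))

/-- If `φ : M → N` is injective on sections over affine opens and `N` is of affine-finite type, so is
`M` (`X` locally Noetherian: `Γ(V, 𝒪_X)` is a Noetherian ring, Mathlib
`IsLocallyNoetherian.component_noetherian`). [folklore] -/
theorem of_app_injective [IsLocallyNoetherian X] {M N : X.Modules} (φ : M ⟶ N)
    (hφ : ∀ ⦃V : X.Opens⦄, IsAffineOpen V → Function.Injective (φ.app V)) (hN : IsAffineFiniteType N) :
    IsAffineFiniteType M := by
  intro V hV
  haveI := hN hV
  haveI : IsNoetherianRing Γ(X, V) := IsLocallyNoetherian.component_noetherian ⟨V, hV⟩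
  haveI : IsNoetherian Γ(X, V) Γ(N, V) := isNoetherian_of_isNoetherianRing_of_finite _ _
  exact Module.Finite.of_injective (appLinear φ V) (hφ hV)

/-- If `ψ : M → N` is surjective on sections over affine opens and `M` is of affine-finite type, so is
`N`. [folklore] -/
theorem of_app_surjective {M N : X.Modules} (ψ : M ⟶ N)
    (hψ : ∀ ⦃V : X.Opens⦄, IsAffineOpen V → Function.Surjective (ψ.app V)) (hM : IsAffineFiniteType M) :
    IsAffineFiniteType N := by
  intro V hV
  haveI := hM hV
  exact Module.Finite.of_surjective (appLinear ψ V) (hψ hV)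

/-- Affine-finite type is invariant under isomorphisms. [folklore] -/
theorem of_iso {M N : X.Modules} (e : M ≅ N) (hM : IsAffineFiniteType M) : IsAffineFiniteType N := by
  refine of_app_surjective e.hom (fun V _ n => ?_) hM
  refine ⟨e.inv.app V n, ?_⟩
  change (e.inv ≫ e.hom).app V n = n
  rw [e.inv_hom_id]
  rfl

/-- **Kernels** of morphisms out of modules of affine-finite type are of affine-finite type (`X` locally
Noetherian). [cite: Hartshorne1977, II Prop. 5.7 (p. 114)] -/
theorem kernel [IsLocallyNoetherian X] {M N : X.Modules} (φ : M ⟶ N) (hM : IsAffineFiniteType M) :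
    IsAffineFiniteType (Limits.kernel φ) :=
  of_app_injective (kernel.ι φ) (fun V _ => kernel_ι_app_injective φ V) hM

/-- **Torsion subsheaves** `M[𝒥]` of modules of affine-finite type are of affine-finite type (`X`
locally Noetherian). [folklore] -/
theorem torsion [IsLocallyNoetherian X] {M : X.Modules} (J : X.IdealSheafData) (hM : IsAffineFiniteType M) :
    IsAffineFiniteType (Literature.AlgebraicGeometry.Modules.torsion M J) :=
  of_app_injective (torsionι M J) (fun V _ => torsionι_app_injective M J V) hM

/-- **Quotients**: in a short exact sequence `0 → M' → M → M'' → 0` with `M'` affine-localizing (so that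
sections over affine opens are right exact) and `M` of affine-finite type, `M''` is of affine-finite type.
[cite: Hartshorne1977, II Prop. 5.7 (p. 114) with Prop. 5.6 (p. 113)] -/
theorem of_shortExact₃ {S : ShortComplex X.Modules} (hS : S.ShortExact) (h₁ : IsAffineLocalizing S.X₁)
    (h₂ : IsAffineFiniteType S.X₂) : IsAffineFiniteType S.X₃ :=
  of_app_surjective S.g (fun _ hV => app_surjective_of_shortExact hS h₁ hV) h₂

/-- **Extensions**: in a short exact sequence `0 → M' → M → M'' → 0` with `M'` affine-localizing and
`M'`, `M''` of affine-finite type, `M` is of affine-finite type (`Γ(V, M)/Γ(V, M') = Γ(V, M'')` for affine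
`V`). [cite: Hartshorne1977, II Prop. 5.7 (p. 114) with Prop. 5.6 (p. 113)] -/
theorem of_shortExact₂ {S : ShortComplex X.Modules} (hS : S.ShortExact) (h₁ : IsAffineLocalizing S.X₁)
    (h₁' : IsAffineFiniteType S.X₁) (h₃ : IsAffineFiniteType S.X₃) : IsAffineFiniteType S.X₂ := by
  intro V hV
  haveI := h₁' hV
  haveI := h₃ hV
  have hsurj : Function.Surjective (appLinear S.g V) := app_surjective_of_shortExact hS h₁ hV
  have hker : LinearMap.ker (appLinear S.g V) = LinearMap.range (appLinear S.f V) := by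
    ext m
    rw [LinearMap.mem_ker, LinearMap.mem_range, appLinear_apply]
    constructor
    · intro hm
      obtain ⟨m', hm'⟩ := (sections_exact_of_shortExact hS V).2 m hm
      exact ⟨m', hm'⟩
    · rintro ⟨m', rfl⟩
      exact app_app_eq_zero S V m'
  refine Module.Finite.of_fg_top (Submodule.fg_of_fg_map_of_fg_inf_ker (appLinear S.g V) ?_ ?_)
  · rw [Submodule.map_top, LinearMap.range_eq_top.mpr hsurj]
    exact Module.Finite.fg_top
  · rw [top_inf_eq, hker, ← Submodule.map_top]
    exact Module.Finite.fg_top.map _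


/-! ## Push-forwards along finite morphisms -/

/-- **`g_*𝒪_Y` is of affine-finite type for `g : Y → X` finite**: `Γ(g⁻¹V, 𝒪_Y)` is a finite
`Γ(V, 𝒪_X)`-module for affine `V` (finite = integral + finite type on affine opens; Mathlib
`Scheme.Hom.isIntegral_app`, `HasRingHomProperty.appLE`, `RingHom.IsIntegral.to_finite`). [folklore] -/
theorem pushforward_unit {Y : Scheme.{u}} (g : Y ⟶ X) [IsFinite g] :
    IsAffineFiniteType ((Scheme.Modules.pushforward g).obj (SheafOfModules.unit Y.ringCatSheaf)) := by
  intro V hV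
  have hint : (g.app V).hom.IsIntegral := g.isIntegral_app V hV
  have hft : (g.app V).hom.FiniteType := by
    have h := HasRingHomProperty.appLE @LocallyOfFiniteType g inferInstance ⟨V, hV⟩
      ⟨g ⁻¹ᵁ V, hV.preimage g⟩ (le_rfl : g ⁻¹ᵁ V ≤ g ⁻¹ᵁ V)
    rwa [← Scheme.Hom.app_eq_appLE] at h
  exact hint.to_finite hft

end IsAffineFiniteType

end Literature.AlgebraicGeometry.Modules

end
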